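/-
Origin: expansion seat `prover-pub-hodgecm-mc-binder-2-g14-0`, handover #S11 2026-08-20T12:17Z md5 de1f216699dc (PKG 284af076afcc → de1f216699dc; 654 l.; §3 σ-implicit + `torusSwap_one`, `cAt_torusSwap`, THE ORIENTATION MATCH AT THE TWISTED POINT `eSigmaAt_torusSwap_archOf` (`eSigmaAt_archOf` = its `σ = 1` case); NAME LIST: HodgeCM.Model.HypCensus.eSigmaAt_torusSwap_archOf · HodgeCM.Model.HypCensus.eSigmaAt_archOf · HodgeCM.Model.HypCensus.linSubst_torusLetter_placePoly_famOf) (`HOME/mc/pub-hodgecm-mc-binder-2/g14/s5b/HodgeCM/Model/HypCensus/OmgInsLetters.lean`, md5 de1f216699dc, 654 lines);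
landed by the gen-20 packager (p-g20) in gate run 51 REPLACES the earlier landed copy of `HodgeCM/Model/HypCensus/OmgInsLetters.lean` (verbatim).
-/
/-
Copyright (c) 2026. All rights reserved.
Released under Apache 2.0 license as described in the file LICENSE.
-/
import Summits.HodgeConjecture.HodgeCM.Model.HypCensus.OmgOrient
import Summits.HodgeConjecture.HodgeCM.Model.HypCensus.InsMemDatumAt
import Summits.HodgeConjecture.HodgeCM.PerL34.FockPrintTorusOrbit_2
import Summits.HodgeConjecture.HodgeCM.Model.HypCensus.IsoTwist_2

/-!
# Census kit (rows 17/18/19), (T12): the `∀ φ` torus junction `omg_ins` from the orientation-aware census, modulo (J-μ)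

RULING SUPPLEMENT 5 (B1), 2026-08-20 (STATUS l.13077).  With the printed `Σ₁₂` model orientation-aware (`PlaceKind.sigmaSwap`,
`LocalFock.ofPrintMCircleSwap`) and the census choosing the swapped datum exactly at the places with `ε_b = −1`
(`PlaceChoice.datumAt`), the torus junction of E's rows 17/18/19 — `ω(ι_T t)(ins f φ) = ins f (ω_T(t) φ)` for EVERY printed
vector `φ` — follows from the single scalar identity (J-μ) `hμ` on the torus that already governs the vacuum case
(`OmgInsPin.omgW_ins_vacuum_eq_of_weight`).  Route:

* §1 kind level: the `Σ`-exponent `sigmaIdx k i` and the polynomial excess weight `polyExcess k i u` of the member `i` of pv11's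
  printed eigenfamily `locFam k` (`P^n` at the `Σ₁₂` kinds, any vector at the line kinds), and `locFam`'s torus weight split as
  `χ_k · polyExcess`;
* §2 place level: under the place torus letter, the embedded `locFam` member at a `Σ₁₂` place is an eigenvector with eigenvalue
  `(c_{r₀} c_{s₀}⁻¹)^n` (positive `V`-reading, either orientation) / `(c_{s₀} c_{r₀}⁻¹)^n` (negative reading) — #14 and #79;
* §3 pin level (`datumAt`): the per-place eigenvalue `dLetterAt = dAt · eSigmaAt` at every place, and the ORIENTATION MATCH
  `eSigmaAt i (cmPlacesEquiv b) (archOf t) = polyExcess _ (i b) (kindCoord (t b))` — the content of (T12);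
* §4 the junction on pure tensors of `locFam` members (`OmgInsTorus.cmPairRepTwist_torus_ins_tprod_of_eigen` + `hμ`), and on every
  `φ` by linearity (pure tensors of the spanning families span `⨂_b`, `locFam_span`).

KERNEL only: 0 records, nothing cited as hypothesis beyond the (J-μ) scalar identity `hμ` (the same hypothesis as at the vacuum);
nothing here is a claim of PerL/QW8.
-/

set_option autoImplicit false

noncomputable section

open NumberField NumberField.InfinitePlace
open scoped TensorProduct Classical ComplexConjugate
open MvPolynomial
open Literature.NumberTheory.Automorphic Literature.NumberTheory.Automorphic.UnitaryGroup Literature.NumberTheory.Weil1964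
open Literature.RepresentationTheory.KonnoKonno2007 Literature.RepresentationTheory.KonnoKonno2007.RealDualPair
open Literature.NumberTheory.GelbartRogawski1991 Literature.NumberTheory.GelbartRogawski1991.UnitaryDualPair
open Literature.Analysis.SegalBargmann
open HodgeCM HodgeCM.Model HodgeCM.Adelic
open HodgeCM.PerL34.Fock HodgeCM.PerL34.Fock.PrintDict
open NumberField.SeesawArchTorus

namespace HodgeCM.Model.HypCensus

/-! ## §1 Kind level: the `Σ`-exponent and the polynomial excess weight of a `locFam` member -/

section Kinds

/-- the `Σ`-exponent of the member `i` of the printed eigenfamily: `n` for `P^n` at either `Σ₁₂` kind, `0` at the line kinds. -/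
def sigmaIdx : (k : PlaceKind) → locIdx k → ℕ
  | .sigma, n => n
  | .delta, _ => 0
  | .iota, _ => 0
  | .sigmaSwap, n => n

/-- the base ratio of the polynomial torus weight of each kind, in torus coordinates `u`: `u₁ u₂⁻¹` at `Σ₁₂`, `u₂ u₁⁻¹` at a
swapped `Σ₁₂` (T12), `1` at the line kinds. -/
def baseRatio : PlaceKind → Circle × Circle → ℂ
  | .sigma, u => ((u.1 : Circle) : ℂ) * (((u.2 : Circle) : ℂ))⁻¹
  | .delta, _ => 1
  | .iota, _ => 1
  | .sigmaSwap, u => ((u.2 : Circle) : ℂ) * (((u.1 : Circle) : ℂ))⁻¹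

/-- the polynomial excess weight of the member `i` over the printed character `χ_k`: `baseRatio ^ sigmaIdx`. -/
def polyExcess (k : PlaceKind) (i : locIdx k) (u : Circle × Circle) : ℂ :=
  baseRatio k u ^ sigmaIdx k i

variable (lam : ℂ) (hlam : lam ≠ 0) (vac : Circle × Circle →* Circle)

/-- **the torus weight of a `locFam` member splits as printed character × polynomial excess** (`locFam_eigen` +
`printLoc_χ_sigma/_delta/_iota/_sigmaSwap`). -/
theorem locFam_weight_eq_χ_mul_polyExcess : ∀ (k : PlaceKind) (i : locIdx k) (u : Circle × Circle),
    ((vac u : Circle) : ℂ) * (((u.1 : Circle) : ℂ) ^ (locWt k i).1 * ((u.2 : Circle) : ℂ) ^ (locWt k i).2) =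
      (printLoc lam hlam vac k).χ ((kindCoord lam hlam vac k).symm u) * polyExcess k i u
  | .sigma, n, u => by
    rw [show (printLoc lam hlam vac .sigma).χ ((kindCoord lam hlam vac .sigma).symm u) = ((vac u : Circle) : ℂ) from rfl]
    simp only [locWt, polyExcess, baseRatio, sigmaIdx, zpow_neg, zpow_natCast, mul_pow, inv_pow]
  | .delta, x, u => by
    rw [show (printLoc lam hlam vac .delta).χ ((kindCoord lam hlam vac .delta).symm u) = ((vac u : Circle) : ℂ) from
      printLoc_χ_delta lam hlam vac u]
    simp only [locWt, polyExcess, baseRatio, sigmaIdx, zpow_zero, mul_one, pow_zero]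
  | .iota, x, u => by
    rw [show (printLoc lam hlam vac .iota).χ ((kindCoord lam hlam vac .iota).symm u) =
      ((vac u : Circle) : ℂ) * (((u.1 : Circle) : ℂ) * ((u.2 : Circle) : ℂ)) from printLoc_χ_iota lam hlam vac u]
    simp only [locWt, polyExcess, baseRatio, sigmaIdx, zpow_one, mul_one, pow_zero]
  | .sigmaSwap, n, u => by
    rw [show (printLoc lam hlam vac .sigmaSwap).χ ((kindCoord lam hlam vac .sigmaSwap).symm u) = ((vac u : Circle) : ℂ) from rfl]
    simp only [locWt, polyExcess, baseRatio, sigmaIdx, zpow_neg, zpow_natCast, mul_pow, inv_pow]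
    ring

/-- the printed torus on a `locFam` member, weight in the split form. -/
theorem printLoc_ω_locFam (k : PlaceKind) (i : locIdx k) (t : (printLoc lam hlam vac k).T) :
    (printLoc lam hlam vac k).ω t (locFam lam hlam vac k i) =
      ((printLoc lam hlam vac k).χ t * polyExcess k i (kindCoord lam hlam vac k t)) • locFam lam hlam vac k i := by
  have h := locFam_eigen lam hlam vac k i (kindCoord lam hlam vac k t)
  rw [MulEquiv.symm_apply_apply] at h
  rw [h, locFam_weight_eq_χ_mul_polyExcess, MulEquiv.symm_apply_apply]

end Kinds

/-! ## §2 Place level: the torus letter on an embedded `locFam` member at a `Σ₁₂` place (four data) -/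

section Place

variable (L : Type) [Field L] [NumberField L] [IsCMField L]
variable (dV : Fin 3 → L) (hdV : ∀ i, IsCMField.complexConj L (dV i) = dV i)
variable (dW : Fin 2 → L) (hdW : ∀ i, IsCMField.complexConj L (dW i) = dW i) (ι₁ : L →+* ℂ)
variable (v : {v : InfinitePlace ↥(maximalRealSubfield L) // v.IsReal})

/-- common core of the four `Σ₁₂` eigen-lemmas: a datum whose variable identification is `(cmIdx v)⁻¹ ∘ j` and whose kind has
`locFam k i` included as `P^(sigmaIdx k i)`, under a letter whose substitution scales `rename j (P^n)` by `e^n`. -/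
theorem linSubst_reindex_rename_cmIdx_symm (j : HodgeCM.PerL34.Fock.MixedVar → DPIdx (PosIdx (cmXV L dV hdV ι₁ v))
      (NegIdx (cmXV L dV hdV ι₁ v)) (PosIdx (cmXW L dV dW hdW ι₁ v)) (NegIdx (cmXW L dV dW hdW ι₁ v)))
    (K : Matrix.unitaryGroup (DPIdx (PosIdx (cmXV L dV hdV ι₁ v)) (NegIdx (cmXV L dV hdV ι₁ v)) (PosIdx (cmXW L dV dW hdW ι₁ v))
      (NegIdx (cmXW L dV dW hdW ι₁ v))) ℂ) (F : HodgeCM.PerL34.Fock.MixedModel) (e : ℂ)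
    (hK : linSubst (star (K : Matrix _ _ ℂ)) (rename j F) = e • rename j F) :
    linSubst (star ((reindexUnitary (pairFrame (PosIdx (cmXV L dV hdV ι₁ v)) (NegIdx (cmXV L dV hdV ι₁ v))
        (PosIdx (cmXW L dV dW hdW ι₁ v)) (NegIdx (cmXW L dV dW hdW ι₁ v)) finProdFinEquiv (cmEpsV L dV hdV ι₁ v) (cmEpsW L dV dW hdW ι₁ v))
        K : Matrix.unitaryGroup (Fin 6) ℂ) : Matrix (Fin 6) (Fin 6) ℂ))
        (rename (fun x => (cmIdx L dV hdV dW hdW ι₁ v).symm (j x)) F) =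
      e • rename (fun x => (cmIdx L dV hdV dW hdW ι₁ v).symm (j x)) F := by
  have hidx : (fun x => (cmIdx L dV hdV dW hdW ι₁ v).symm (j x)) =
      (pairFrame (PosIdx (cmXV L dV hdV ι₁ v)) (NegIdx (cmXV L dV hdV ι₁ v)) (PosIdx (cmXW L dV dW hdW ι₁ v))
        (NegIdx (cmXW L dV dW hdW ι₁ v)) finProdFinEquiv (cmEpsV L dV hdV ι₁ v) (cmEpsW L dV dW hdW ι₁ v)).symm ∘ j := by
    funext x
    rw [cmIdx_eq_pairFrame]
    rfl
  rw [hidx, ← rename_rename, linSubst_star_reindexUnitary_rename, hK, map_smul]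

/-- **`Σ₁₂`, `V` read positive, printed orientation as is**: eigenvalue `(c_{r₀} c_{s₀}⁻¹)^n` on the embedded `P^n`. -/
theorem linSubst_torusLetter_emb_locFam_of_eq_sigmaPos (eA : Fin 3 ≃ PosIdx (cmXV L dV hdV ι₁ v))
    (hQ : IsEmpty (NegIdx (cmXV L dV hdV ι₁ v))) (r₀ : PosIdx (cmXW L dV dW hdW ι₁ v)) (s₀ : NegIdx (cmXW L dV dW hdW ι₁ v))
    (hR : Subsingleton (PosIdx (cmXW L dV dW hdW ι₁ v))) (hS : Subsingleton (NegIdx (cmXW L dV dW hdW ι₁ v))) (u : SeesawArchTorus L) :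
    ∀ (d : PlaceDatum L dV hdV dW hdW ι₁ v), d = PlaceDatum.sigmaPos eA hQ r₀ s₀ hR hS → ∀ (vac : Circle × Circle →* Circle)
      (i : locIdx d.kind),
      linSubst (star ((reindexUnitary (pairFrame (PosIdx (cmXV L dV hdV ι₁ v)) (NegIdx (cmXV L dV hdV ι₁ v))
          (PosIdx (cmXW L dV dW hdW ι₁ v)) (NegIdx (cmXW L dV dW hdW ι₁ v)) finProdFinEquiv (cmEpsV L dV hdV ι₁ v) (cmEpsW L dV dW hdW ι₁ v))
          (dualPairι (torusPlaceLetter L dV hdV dW hdW ι₁ v u)) : Matrix.unitaryGroup (Fin 6) ℂ) : Matrix (Fin 6) (Fin 6) ℂ))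
          (d.emb vac (locFam d.lam d.lam_ne_zero vac d.kind i)) =
        ((((torusPlaceCircles L v u r₀.1 : Circle) : ℂ) * (((torusPlaceCircles L v u s₀.1 : Circle) : ℂ))⁻¹) ^ sigmaIdx d.kind i) •
          d.emb vac (locFam d.lam d.lam_ne_zero vac d.kind i) := by
  rintro d rfl vac n
  rw [PlaceDatum.emb_apply]
  change linSubst _ (rename (fun x => (cmIdx L dV hdV dW hdW ι₁ v).symm (mixedToDPIdx (NegIdx (cmXV L dV hdV ι₁ v)) eA r₀ s₀ x))
      (HodgeCM.PerL34.Fock.P ^ sigmaIdx PlaceKind.sigma n)) =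
    (((torusPlaceCircles L v u r₀.1 : Circle) : ℂ) * (((torusPlaceCircles L v u s₀.1 : Circle) : ℂ))⁻¹) ^ sigmaIdx PlaceKind.sigma n •
      rename (fun x => (cmIdx L dV hdV dW hdW ι₁ v).symm (mixedToDPIdx (NegIdx (cmXV L dV hdV ι₁ v)) eA r₀ s₀ x))
        (HodgeCM.PerL34.Fock.P ^ sigmaIdx PlaceKind.sigma n)
  refine linSubst_reindex_rename_cmIdx_symm L dV hdV dW hdW ι₁ v _ _ _ _ ?_
  rw [torusPlaceLetter_eq_torusLetter L dV hdV dW hdW ι₁ v r₀ s₀ hR hS, linSubst_star_dualPairι_torusLetter_rename, scalePi_P_pow,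
    map_smul, Units.val_inv_eq_inv_val, circleUnits_fst_coe, circleUnits_snd_coe]

/-- **`Σ₁₂`, `V` read positive, SWAPPED printed orientation**: the same eigenvalue `(c_{r₀} c_{s₀}⁻¹)^n` (the Weil side does not see
the printed orientation). -/
theorem linSubst_torusLetter_emb_locFam_of_eq_sigmaPosSwap (eA : Fin 3 ≃ PosIdx (cmXV L dV hdV ι₁ v))
    (hQ : IsEmpty (NegIdx (cmXV L dV hdV ι₁ v))) (r₀ : PosIdx (cmXW L dV dW hdW ι₁ v)) (s₀ : NegIdx (cmXW L dV dW hdW ι₁ v))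
    (hR : Subsingleton (PosIdx (cmXW L dV dW hdW ι₁ v))) (hS : Subsingleton (NegIdx (cmXW L dV dW hdW ι₁ v))) (u : SeesawArchTorus L) :
    ∀ (d : PlaceDatum L dV hdV dW hdW ι₁ v), d = PlaceDatum.sigmaPosSwap eA hQ r₀ s₀ hR hS → ∀ (vac : Circle × Circle →* Circle)
      (i : locIdx d.kind),
      linSubst (star ((reindexUnitary (pairFrame (PosIdx (cmXV L dV hdV ι₁ v)) (NegIdx (cmXV L dV hdV ι₁ v))
          (PosIdx (cmXW L dV dW hdW ι₁ v)) (NegIdx (cmXW L dV dW hdW ι₁ v)) finProdFinEquiv (cmEpsV L dV hdV ι₁ v) (cmEpsW L dV dW hdW ι₁ v))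
          (dualPairι (torusPlaceLetter L dV hdV dW hdW ι₁ v u)) : Matrix.unitaryGroup (Fin 6) ℂ) : Matrix (Fin 6) (Fin 6) ℂ))
          (d.emb vac (locFam d.lam d.lam_ne_zero vac d.kind i)) =
        ((((torusPlaceCircles L v u r₀.1 : Circle) : ℂ) * (((torusPlaceCircles L v u s₀.1 : Circle) : ℂ))⁻¹) ^ sigmaIdx d.kind i) •
          d.emb vac (locFam d.lam d.lam_ne_zero vac d.kind i) := by
  rintro d rfl vac n
  rw [PlaceDatum.emb_apply]
  change linSubst _ (rename (fun x => (cmIdx L dV hdV dW hdW ι₁ v).symm (mixedToDPIdx (NegIdx (cmXV L dV hdV ι₁ v)) eA r₀ s₀ x))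
      (HodgeCM.PerL34.Fock.P ^ sigmaIdx PlaceKind.sigmaSwap n)) =
    (((torusPlaceCircles L v u r₀.1 : Circle) : ℂ) * (((torusPlaceCircles L v u s₀.1 : Circle) : ℂ))⁻¹) ^ sigmaIdx PlaceKind.sigmaSwap n •
      rename (fun x => (cmIdx L dV hdV dW hdW ι₁ v).symm (mixedToDPIdx (NegIdx (cmXV L dV hdV ι₁ v)) eA r₀ s₀ x))
        (HodgeCM.PerL34.Fock.P ^ sigmaIdx PlaceKind.sigmaSwap n)
  refine linSubst_reindex_rename_cmIdx_symm L dV hdV dW hdW ι₁ v _ _ _ _ ?_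
  rw [torusPlaceLetter_eq_torusLetter L dV hdV dW hdW ι₁ v r₀ s₀ hR hS, linSubst_star_dualPairι_torusLetter_rename, scalePi_P_pow,
    map_smul, Units.val_inv_eq_inv_val, circleUnits_fst_coe, circleUnits_snd_coe]

/-- **`Σ₁₂`, `V` read negative, printed orientation as is**: eigenvalue `(c_{s₀} c_{r₀}⁻¹)^n` (#79 `…_rename_neg`). -/
theorem linSubst_torusLetter_emb_locFam_of_eq_sigmaNeg (eA : Fin 3 ≃ NegIdx (cmXV L dV hdV ι₁ v))
    (hP : IsEmpty (PosIdx (cmXV L dV hdV ι₁ v))) (r₀ : PosIdx (cmXW L dV dW hdW ι₁ v)) (s₀ : NegIdx (cmXW L dV dW hdW ι₁ v))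
    (hR : Subsingleton (PosIdx (cmXW L dV dW hdW ι₁ v))) (hS : Subsingleton (NegIdx (cmXW L dV dW hdW ι₁ v))) (u : SeesawArchTorus L) :
    ∀ (d : PlaceDatum L dV hdV dW hdW ι₁ v), d = PlaceDatum.sigmaNeg eA hP r₀ s₀ hR hS → ∀ (vac : Circle × Circle →* Circle)
      (i : locIdx d.kind),
      linSubst (star ((reindexUnitary (pairFrame (PosIdx (cmXV L dV hdV ι₁ v)) (NegIdx (cmXV L dV hdV ι₁ v))
          (PosIdx (cmXW L dV dW hdW ι₁ v)) (NegIdx (cmXW L dV dW hdW ι₁ v)) finProdFinEquiv (cmEpsV L dV hdV ι₁ v) (cmEpsW L dV dW hdW ι₁ v))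
          (dualPairι (torusPlaceLetter L dV hdV dW hdW ι₁ v u)) : Matrix.unitaryGroup (Fin 6) ℂ) : Matrix (Fin 6) (Fin 6) ℂ))
          (d.emb vac (locFam d.lam d.lam_ne_zero vac d.kind i)) =
        ((((torusPlaceCircles L v u s₀.1 : Circle) : ℂ) * (((torusPlaceCircles L v u r₀.1 : Circle) : ℂ))⁻¹) ^ sigmaIdx d.kind i) •
          d.emb vac (locFam d.lam d.lam_ne_zero vac d.kind i) := by
  rintro d rfl vac n
  rw [PlaceDatum.emb_apply]
  change linSubst _ (rename (fun x => (cmIdx L dV hdV dW hdW ι₁ v).symm (mixedToDPIdxNeg (PosIdx (cmXV L dV hdV ι₁ v)) eA r₀ s₀ x))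
      (HodgeCM.PerL34.Fock.P ^ sigmaIdx PlaceKind.sigma n)) =
    (((torusPlaceCircles L v u s₀.1 : Circle) : ℂ) * (((torusPlaceCircles L v u r₀.1 : Circle) : ℂ))⁻¹) ^ sigmaIdx PlaceKind.sigma n •
      rename (fun x => (cmIdx L dV hdV dW hdW ι₁ v).symm (mixedToDPIdxNeg (PosIdx (cmXV L dV hdV ι₁ v)) eA r₀ s₀ x))
        (HodgeCM.PerL34.Fock.P ^ sigmaIdx PlaceKind.sigma n)
  refine linSubst_reindex_rename_cmIdx_symm L dV hdV dW hdW ι₁ v _ _ _ _ ?_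
  rw [torusPlaceLetter_eq_torusLetter L dV hdV dW hdW ι₁ v r₀ s₀ hR hS, linSubst_star_dualPairι_torusLetter_rename_neg, scalePi_P_pow,
    map_smul, Units.val_inv_eq_inv_val, circleUnits_fst_coe, circleUnits_snd_coe]

/-- **`Σ₁₂`, `V` read negative, SWAPPED printed orientation**: the same eigenvalue `(c_{s₀} c_{r₀}⁻¹)^n`. -/
theorem linSubst_torusLetter_emb_locFam_of_eq_sigmaNegSwap (eA : Fin 3 ≃ NegIdx (cmXV L dV hdV ι₁ v))
    (hP : IsEmpty (PosIdx (cmXV L dV hdV ι₁ v))) (r₀ : PosIdx (cmXW L dV dW hdW ι₁ v)) (s₀ : NegIdx (cmXW L dV dW hdW ι₁ v))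
    (hR : Subsingleton (PosIdx (cmXW L dV dW hdW ι₁ v))) (hS : Subsingleton (NegIdx (cmXW L dV dW hdW ι₁ v))) (u : SeesawArchTorus L) :
    ∀ (d : PlaceDatum L dV hdV dW hdW ι₁ v), d = PlaceDatum.sigmaNegSwap eA hP r₀ s₀ hR hS → ∀ (vac : Circle × Circle →* Circle)
      (i : locIdx d.kind),
      linSubst (star ((reindexUnitary (pairFrame (PosIdx (cmXV L dV hdV ι₁ v)) (NegIdx (cmXV L dV hdV ι₁ v))
          (PosIdx (cmXW L dV dW hdW ι₁ v)) (NegIdx (cmXW L dV dW hdW ι₁ v)) finProdFinEquiv (cmEpsV L dV hdV ι₁ v) (cmEpsW L dV dW hdW ι₁ v))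
          (dualPairι (torusPlaceLetter L dV hdV dW hdW ι₁ v u)) : Matrix.unitaryGroup (Fin 6) ℂ) : Matrix (Fin 6) (Fin 6) ℂ))
          (d.emb vac (locFam d.lam d.lam_ne_zero vac d.kind i)) =
        ((((torusPlaceCircles L v u s₀.1 : Circle) : ℂ) * (((torusPlaceCircles L v u r₀.1 : Circle) : ℂ))⁻¹) ^ sigmaIdx d.kind i) •
          d.emb vac (locFam d.lam d.lam_ne_zero vac d.kind i) := by
  rintro d rfl vac n
  rw [PlaceDatum.emb_apply]
  change linSubst _ (rename (fun x => (cmIdx L dV hdV dW hdW ι₁ v).symm (mixedToDPIdxNeg (PosIdx (cmXV L dV hdV ι₁ v)) eA r₀ s₀ x))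
      (HodgeCM.PerL34.Fock.P ^ sigmaIdx PlaceKind.sigmaSwap n)) =
    (((torusPlaceCircles L v u s₀.1 : Circle) : ℂ) * (((torusPlaceCircles L v u r₀.1 : Circle) : ℂ))⁻¹) ^ sigmaIdx PlaceKind.sigmaSwap n •
      rename (fun x => (cmIdx L dV hdV dW hdW ι₁ v).symm (mixedToDPIdxNeg (PosIdx (cmXV L dV hdV ι₁ v)) eA r₀ s₀ x))
        (HodgeCM.PerL34.Fock.P ^ sigmaIdx PlaceKind.sigmaSwap n)
  refine linSubst_reindex_rename_cmIdx_symm L dV hdV dW hdW ι₁ v _ _ _ _ ?_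
  rw [torusPlaceLetter_eq_torusLetter L dV hdV dW hdW ι₁ v r₀ s₀ hR hS, linSubst_star_dualPairι_torusLetter_rename_neg, scalePi_P_pow,
    map_smul, Units.val_inv_eq_inv_val, circleUnits_fst_coe, circleUnits_snd_coe]

end Place

/-! ### family level: the same on the place polynomial of a family whose member at `b` is a `locFam` member -/

section Family

variable (L : Type) [Field L] [NumberField L] [IsCMField L]
variable (dV : Fin 3 → L) (hdV : ∀ i, IsCMField.complexConj L (dV i) = dV i)
variable (dW : Fin 2 → L) (hdW : ∀ i, IsCMField.complexConj L (dW i) = dW i) (ι₁ : L →+* ℂ)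
variable (datum : ∀ b : InfinitePlace L, PlaceDatum L dV hdV dW hdW ι₁ (cmPlacesEquiv L b)) (m₁ m₂ : InfinitePlace L → ℤ)

/-- family level, datum `sigmaPos` at `b`. -/
theorem linSubst_torusLetter_placePoly_locFam_of_eq_sigmaPos (b : InfinitePlace L) (eA : Fin 3 ≃ PosIdx (cmXV L dV hdV ι₁ (cmPlacesEquiv L b)))
    (hQ : IsEmpty (NegIdx (cmXV L dV hdV ι₁ (cmPlacesEquiv L b)))) (r₀ : PosIdx (cmXW L dV dW hdW ι₁ (cmPlacesEquiv L b)))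
    (s₀ : NegIdx (cmXW L dV dW hdW ι₁ (cmPlacesEquiv L b))) (hR : Subsingleton (PosIdx (cmXW L dV dW hdW ι₁ (cmPlacesEquiv L b))))
    (hS : Subsingleton (NegIdx (cmXW L dV dW hdW ι₁ (cmPlacesEquiv L b)))) (hσ : datum b = PlaceDatum.sigmaPos eA hQ r₀ s₀ hR hS)
    (u : SeesawArchTorus L)
    (m : ∀ b : InfinitePlace L, ((printPlaces (InfinitePlace L) (kindOf L dV hdV dW hdW ι₁ datum)
      (lamOf L dV hdV dW hdW ι₁ datum) (lamOf_ne_zero L dV hdV dW hdW ι₁ datum)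
      (pinnedVacs (kindOf L dV hdV dW hdW ι₁ datum) m₁ m₂)).loc b).M)
    (n : locIdx (datum b).kind)
    (hm : m b = locFam (lamOf L dV hdV dW hdW ι₁ datum b) (lamOf_ne_zero L dV hdV dW hdW ι₁ datum b)
      (pinnedVacs (kindOf L dV hdV dW hdW ι₁ datum) m₁ m₂ b) (kindOf L dV hdV dW hdW ι₁ datum b) n) :
    linSubst (star ((reindexUnitary (pairFrame (PosIdx (cmXV L dV hdV ι₁ (cmPlacesEquiv L b))) (NegIdx (cmXV L dV hdV ι₁ (cmPlacesEquiv L b)))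
        (PosIdx (cmXW L dV dW hdW ι₁ (cmPlacesEquiv L b))) (NegIdx (cmXW L dV dW hdW ι₁ (cmPlacesEquiv L b))) finProdFinEquiv
        (cmEpsV L dV hdV ι₁ (cmPlacesEquiv L b)) (cmEpsW L dV dW hdW ι₁ (cmPlacesEquiv L b)))
        (dualPairι (torusPlaceLetter L dV hdV dW hdW ι₁ (cmPlacesEquiv L b) u)) : Matrix.unitaryGroup (Fin 6) ℂ) : Matrix (Fin 6) (Fin 6) ℂ))
        (placePoly L dV hdV dW hdW ι₁ datum m₁ m₂ m (cmPlacesEquiv L b)) =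
      ((((torusPlaceCircles L (cmPlacesEquiv L b) u r₀.1 : Circle) : ℂ) * (((torusPlaceCircles L (cmPlacesEquiv L b) u s₀.1 : Circle) : ℂ))⁻¹) ^ sigmaIdx (datum b).kind n) • placePoly L dV hdV dW hdW ι₁ datum m₁ m₂ m (cmPlacesEquiv L b) := by
  rw [placePoly_apply, hm]
  exact linSubst_torusLetter_emb_locFam_of_eq_sigmaPos L dV hdV dW hdW ι₁ (cmPlacesEquiv L b) eA hQ r₀ s₀ hR hS u (datum b) hσ _ n

/-- family level, datum `sigmaPosSwap` at `b`. -/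
theorem linSubst_torusLetter_placePoly_locFam_of_eq_sigmaPosSwap (b : InfinitePlace L) (eA : Fin 3 ≃ PosIdx (cmXV L dV hdV ι₁ (cmPlacesEquiv L b)))
    (hQ : IsEmpty (NegIdx (cmXV L dV hdV ι₁ (cmPlacesEquiv L b)))) (r₀ : PosIdx (cmXW L dV dW hdW ι₁ (cmPlacesEquiv L b)))
    (s₀ : NegIdx (cmXW L dV dW hdW ι₁ (cmPlacesEquiv L b))) (hR : Subsingleton (PosIdx (cmXW L dV dW hdW ι₁ (cmPlacesEquiv L b))))
    (hS : Subsingleton (NegIdx (cmXW L dV dW hdW ι₁ (cmPlacesEquiv L b)))) (hσ : datum b = PlaceDatum.sigmaPosSwap eA hQ r₀ s₀ hR hS)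
    (u : SeesawArchTorus L)
    (m : ∀ b : InfinitePlace L, ((printPlaces (InfinitePlace L) (kindOf L dV hdV dW hdW ι₁ datum)
      (lamOf L dV hdV dW hdW ι₁ datum) (lamOf_ne_zero L dV hdV dW hdW ι₁ datum)
      (pinnedVacs (kindOf L dV hdV dW hdW ι₁ datum) m₁ m₂)).loc b).M)
    (n : locIdx (datum b).kind)
    (hm : m b = locFam (lamOf L dV hdV dW hdW ι₁ datum b) (lamOf_ne_zero L dV hdV dW hdW ι₁ datum b)
      (pinnedVacs (kindOf L dV hdV dW hdW ι₁ datum) m₁ m₂ b) (kindOf L dV hdV dW hdW ι₁ datum b) n) :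
    linSubst (star ((reindexUnitary (pairFrame (PosIdx (cmXV L dV hdV ι₁ (cmPlacesEquiv L b))) (NegIdx (cmXV L dV hdV ι₁ (cmPlacesEquiv L b)))
        (PosIdx (cmXW L dV dW hdW ι₁ (cmPlacesEquiv L b))) (NegIdx (cmXW L dV dW hdW ι₁ (cmPlacesEquiv L b))) finProdFinEquiv
        (cmEpsV L dV hdV ι₁ (cmPlacesEquiv L b)) (cmEpsW L dV dW hdW ι₁ (cmPlacesEquiv L b)))
        (dualPairι (torusPlaceLetter L dV hdV dW hdW ι₁ (cmPlacesEquiv L b) u)) : Matrix.unitaryGroup (Fin 6) ℂ) : Matrix (Fin 6) (Fin 6) ℂ))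
        (placePoly L dV hdV dW hdW ι₁ datum m₁ m₂ m (cmPlacesEquiv L b)) =
      ((((torusPlaceCircles L (cmPlacesEquiv L b) u r₀.1 : Circle) : ℂ) * (((torusPlaceCircles L (cmPlacesEquiv L b) u s₀.1 : Circle) : ℂ))⁻¹) ^ sigmaIdx (datum b).kind n) • placePoly L dV hdV dW hdW ι₁ datum m₁ m₂ m (cmPlacesEquiv L b) := by
  rw [placePoly_apply, hm]
  exact linSubst_torusLetter_emb_locFam_of_eq_sigmaPosSwap L dV hdV dW hdW ι₁ (cmPlacesEquiv L b) eA hQ r₀ s₀ hR hS u (datum b) hσ _ n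

/-- family level, datum `sigmaNeg` at `b`. -/
theorem linSubst_torusLetter_placePoly_locFam_of_eq_sigmaNeg (b : InfinitePlace L) (eA : Fin 3 ≃ NegIdx (cmXV L dV hdV ι₁ (cmPlacesEquiv L b)))
    (hP : IsEmpty (PosIdx (cmXV L dV hdV ι₁ (cmPlacesEquiv L b)))) (r₀ : PosIdx (cmXW L dV dW hdW ι₁ (cmPlacesEquiv L b)))
    (s₀ : NegIdx (cmXW L dV dW hdW ι₁ (cmPlacesEquiv L b))) (hR : Subsingleton (PosIdx (cmXW L dV dW hdW ι₁ (cmPlacesEquiv L b))))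
    (hS : Subsingleton (NegIdx (cmXW L dV dW hdW ι₁ (cmPlacesEquiv L b)))) (hσ : datum b = PlaceDatum.sigmaNeg eA hP r₀ s₀ hR hS)
    (u : SeesawArchTorus L)
    (m : ∀ b : InfinitePlace L, ((printPlaces (InfinitePlace L) (kindOf L dV hdV dW hdW ι₁ datum)
      (lamOf L dV hdV dW hdW ι₁ datum) (lamOf_ne_zero L dV hdV dW hdW ι₁ datum)
      (pinnedVacs (kindOf L dV hdV dW hdW ι₁ datum) m₁ m₂)).loc b).M)
    (n : locIdx (datum b).kind)
    (hm : m b = locFam (lamOf L dV hdV dW hdW ι₁ datum b) (lamOf_ne_zero L dV hdV dW hdW ι₁ datum b)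
      (pinnedVacs (kindOf L dV hdV dW hdW ι₁ datum) m₁ m₂ b) (kindOf L dV hdV dW hdW ι₁ datum b) n) :
    linSubst (star ((reindexUnitary (pairFrame (PosIdx (cmXV L dV hdV ι₁ (cmPlacesEquiv L b))) (NegIdx (cmXV L dV hdV ι₁ (cmPlacesEquiv L b)))
        (PosIdx (cmXW L dV dW hdW ι₁ (cmPlacesEquiv L b))) (NegIdx (cmXW L dV dW hdW ι₁ (cmPlacesEquiv L b))) finProdFinEquiv
        (cmEpsV L dV hdV ι₁ (cmPlacesEquiv L b)) (cmEpsW L dV dW hdW ι₁ (cmPlacesEquiv L b)))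
        (dualPairι (torusPlaceLetter L dV hdV dW hdW ι₁ (cmPlacesEquiv L b) u)) : Matrix.unitaryGroup (Fin 6) ℂ) : Matrix (Fin 6) (Fin 6) ℂ))
        (placePoly L dV hdV dW hdW ι₁ datum m₁ m₂ m (cmPlacesEquiv L b)) =
      ((((torusPlaceCircles L (cmPlacesEquiv L b) u s₀.1 : Circle) : ℂ) * (((torusPlaceCircles L (cmPlacesEquiv L b) u r₀.1 : Circle) : ℂ))⁻¹) ^ sigmaIdx (datum b).kind n) • placePoly L dV hdV dW hdW ι₁ datum m₁ m₂ m (cmPlacesEquiv L b) := by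
  rw [placePoly_apply, hm]
  exact linSubst_torusLetter_emb_locFam_of_eq_sigmaNeg L dV hdV dW hdW ι₁ (cmPlacesEquiv L b) eA hP r₀ s₀ hR hS u (datum b) hσ _ n

/-- family level, datum `sigmaNegSwap` at `b`. -/
theorem linSubst_torusLetter_placePoly_locFam_of_eq_sigmaNegSwap (b : InfinitePlace L) (eA : Fin 3 ≃ NegIdx (cmXV L dV hdV ι₁ (cmPlacesEquiv L b)))
    (hP : IsEmpty (PosIdx (cmXV L dV hdV ι₁ (cmPlacesEquiv L b)))) (r₀ : PosIdx (cmXW L dV dW hdW ι₁ (cmPlacesEquiv L b)))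
    (s₀ : NegIdx (cmXW L dV dW hdW ι₁ (cmPlacesEquiv L b))) (hR : Subsingleton (PosIdx (cmXW L dV dW hdW ι₁ (cmPlacesEquiv L b))))
    (hS : Subsingleton (NegIdx (cmXW L dV dW hdW ι₁ (cmPlacesEquiv L b)))) (hσ : datum b = PlaceDatum.sigmaNegSwap eA hP r₀ s₀ hR hS)
    (u : SeesawArchTorus L)
    (m : ∀ b : InfinitePlace L, ((printPlaces (InfinitePlace L) (kindOf L dV hdV dW hdW ι₁ datum)
      (lamOf L dV hdV dW hdW ι₁ datum) (lamOf_ne_zero L dV hdV dW hdW ι₁ datum)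
      (pinnedVacs (kindOf L dV hdV dW hdW ι₁ datum) m₁ m₂)).loc b).M)
    (n : locIdx (datum b).kind)
    (hm : m b = locFam (lamOf L dV hdV dW hdW ι₁ datum b) (lamOf_ne_zero L dV hdV dW hdW ι₁ datum b)
      (pinnedVacs (kindOf L dV hdV dW hdW ι₁ datum) m₁ m₂ b) (kindOf L dV hdV dW hdW ι₁ datum b) n) :
    linSubst (star ((reindexUnitary (pairFrame (PosIdx (cmXV L dV hdV ι₁ (cmPlacesEquiv L b))) (NegIdx (cmXV L dV hdV ι₁ (cmPlacesEquiv L b)))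
        (PosIdx (cmXW L dV dW hdW ι₁ (cmPlacesEquiv L b))) (NegIdx (cmXW L dV dW hdW ι₁ (cmPlacesEquiv L b))) finProdFinEquiv
        (cmEpsV L dV hdV ι₁ (cmPlacesEquiv L b)) (cmEpsW L dV dW hdW ι₁ (cmPlacesEquiv L b)))
        (dualPairι (torusPlaceLetter L dV hdV dW hdW ι₁ (cmPlacesEquiv L b) u)) : Matrix.unitaryGroup (Fin 6) ℂ) : Matrix (Fin 6) (Fin 6) ℂ))
        (placePoly L dV hdV dW hdW ι₁ datum m₁ m₂ m (cmPlacesEquiv L b)) =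
      ((((torusPlaceCircles L (cmPlacesEquiv L b) u s₀.1 : Circle) : ℂ) * (((torusPlaceCircles L (cmPlacesEquiv L b) u r₀.1 : Circle) : ℂ))⁻¹) ^ sigmaIdx (datum b).kind n) • placePoly L dV hdV dW hdW ι₁ datum m₁ m₂ m (cmPlacesEquiv L b) := by
  rw [placePoly_apply, hm]
  exact linSubst_torusLetter_emb_locFam_of_eq_sigmaNegSwap L dV hdV dW hdW ι₁ (cmPlacesEquiv L b) eA hP r₀ s₀ hR hS u (datum b) hσ _ n

end Family


/-! ## §3 Pin level: the per-place letter eigenvalue of the chosen data and the ORIENTATION MATCH -/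

section Pin

variable {L : CMField} {ι₁ : L →+* ℂ} (V : HermSpace3 L ι₁) (S : StubTree.SeesawDatum L)
variable
  (hGR : (cmSplittingDatum (L : Type) finProdFinEquiv (frameD V) (frameD_real V) (frameD_ne V) (dW S) (dW_real S) (dW_ne S)).CompatibleSplitting)
  (η : CMAdelic (L : Type) (frameD V) × CMAdelic (L : Type) (dW S) →* ℂˣ)
  (hη : ∀ γU ∈ CMRat (L : Type) (frameD V), ∀ γ ∈ CMRat (L : Type) (dW S), η (γU, γ) = 1)
  (hηc : Continuous fun p => ((η p : ℂˣ) : ℂ))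
  (τ : L →+* ℂ) (T : GL (Fin 3) ℂ)
  (hT : formCongr (starRingEnd ℂ) T (V.Hm.map τ) = Literature.Geometry.ComplexHyperbolic.BallModel.J)
variable (hW : (∀ j, 0 < (ι₁ ((dW S) j)).re) ∨ ∀ j, (ι₁ ((dW S) j)).re < 0)
variable (jD : InfinitePlace (L : Type) → HodgeCM.PerL34.Fock.EqVar → Fin 6) (m₁ m₂ : InfinitePlace (L : Type) → ℤ)
variable {σ : InfinitePlace (L : Type) → Equiv.Perm (Fin 2)}

/-- the circle coordinate `j` at the complex place over `cmPlacesEquiv b`, of a torus element. -/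
abbrev cAt (b : InfinitePlace (L : Type)) (u : SeesawArchTorus (L : Type)) (j : Fin 2) : ℂ :=
  ((torusPlaceCircles (L : Type) (cmPlacesEquiv (L : Type) b) u j : Circle) : ℂ)

/-- **the `Σ`-part of the letter eigenvalue at the place `b`** (the Weil side does not see the printed orientation):
`(c_{r₀} c_{s₀}⁻¹)^n` if `V_b` reads positive, `(c_{s₀} c_{r₀}⁻¹)^n` if negative, `1` at the places of kind `ι₁` / `D₁₂`. -/
def eSigmaAt (i : ∀ b : InfinitePlace (L : Type), locIdx (datumAtσ V S jD (jIOf V S hW) σ b).kind)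
    (b : InfinitePlace (L : Type)) (u : SeesawArchTorus (L : Type)) : ℂ :=
  if cmPlacesEquiv (L : Type) b = cmPlace (L : Type) ι₁ then 1
  else if hsig : Nonempty (PosIdx (cmXW (L : Type) (frameD V) (dW S) (dW_real S) ι₁ (cmPlacesEquiv (L : Type) b))) ∧
      Nonempty (NegIdx (cmXW (L : Type) (frameD V) (dW S) (dW_real S) ι₁ (cmPlacesEquiv (L : Type) b))) then
    if IsEmpty (NegIdx (cmXV (L : Type) (frameD V) (frameD_real V) ι₁ (cmPlacesEquiv (L : Type) b))) then
      (cAt b u (Classical.choice hsig.1).1 * (cAt b u (Classical.choice hsig.2).1)⁻¹) ^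
        sigmaIdx (datumAtσ V S jD (jIOf V S hW) σ b).kind (i b)
    else
      (cAt b u (Classical.choice hsig.2).1 * (cAt b u (Classical.choice hsig.1).1)⁻¹) ^
        sigmaIdx (datumAtσ V S jD (jIOf V S hW) σ b).kind (i b)
  else 1

/-- **the full letter eigenvalue at the real place `w`**: the `ι₁` det-scalar `dAt` times the `Σ`-part. -/
def dLetterAt (i : ∀ b : InfinitePlace (L : Type), locIdx (datumAtσ V S jD (jIOf V S hW) σ b).kind)
    (w : {v : InfinitePlace ↥(maximalRealSubfield L) // v.IsReal}) (u : SeesawArchTorus (L : Type)) : ℂ :=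
  dAt V S w u * eSigmaAt V S hW jD i ((cmPlacesEquiv (L : Type)).symm w) u

/-- the `locFam` family of a family of indices, as a family of printed local vectors of the census. -/
abbrev famOf (i : ∀ b : InfinitePlace (L : Type), locIdx (datumAtσ V S jD (jIOf V S hW) σ b).kind) (b : InfinitePlace (L : Type)) :
    ((printPlaces (InfinitePlace (L : Type))
      (kindOf (L : Type) (frameD V) (frameD_real V) (dW S) (dW_real S) ι₁ (datumAtσ V S jD (jIOf V S hW) σ))
      (lamOf (L : Type) (frameD V) (frameD_real V) (dW S) (dW_real S) ι₁ (datumAtσ V S jD (jIOf V S hW) σ))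
      (lamOf_ne_zero (L : Type) (frameD V) (frameD_real V) (dW S) (dW_real S) ι₁ (datumAtσ V S jD (jIOf V S hW) σ))
      (pinnedVacs (kindOf (L : Type) (frameD V) (frameD_real V) (dW S) (dW_real S) ι₁ (datumAtσ V S jD (jIOf V S hW) σ)) m₁ m₂)).loc b).M :=
  locFam (lamOf (L : Type) (frameD V) (frameD_real V) (dW S) (dW_real S) ι₁ (datumAtσ V S jD (jIOf V S hW) σ) b)
    (lamOf_ne_zero (L : Type) (frameD V) (frameD_real V) (dW S) (dW_real S) ι₁ (datumAtσ V S jD (jIOf V S hW) σ) b)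
    (pinnedVacs (kindOf (L : Type) (frameD V) (frameD_real V) (dW S) (dW_real S) ι₁ (datumAtσ V S jD (jIOf V S hW) σ)) m₁ m₂ b)
    (kindOf (L : Type) (frameD V) (frameD_real V) (dW S) (dW_real S) ι₁ (datumAtσ V S jD (jIOf V S hW) σ) b) (i b)

/-! ### case values of the scalars -/

/-- (Ported verbatim from the HodgeCMPerL package; no docstring in the source.) -/
theorem dAt_cmPlace (u : SeesawArchTorus (L : Type)) :
    dAt V S (cmPlace (L : Type) ι₁) u = dIotaAt (L : Type) (frameD V) (dW S) (dW_real S) ι₁ u := by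
  unfold dAt; rw [if_pos rfl]

/-- (Ported verbatim from the HodgeCMPerL package; no docstring in the source.) -/
theorem dAt_of_ne (b : InfinitePlace (L : Type)) (hb : cmPlacesEquiv (L : Type) b ≠ cmPlace (L : Type) ι₁) (u : SeesawArchTorus (L : Type)) :
    dAt V S (cmPlacesEquiv (L : Type) b) u = 1 := by
  unfold dAt; rw [if_neg (Ne.symm hb)]


-- port_pkg: scope closed for this part
end Pin
end HodgeCM.Model.HypCensus
end
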